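import Mathlib
import Summits.QuantumFields.BalabanUV.Beta.UnitLatticeOmegaBoxEnd

/-!
# `Summit.QuantumFields.BalabanUV.Beta.UnitLatticeOmegaBoxTilt` — THE x-TILT LAYER (interface item (I4)) ON A BOX OF `ℤ^ν`:
# for the pieces `x·(R·G_ω·Rᵀ)` of the tilt kernel `x·R·G̃₂·Rᵀ` ([II] p. 13) with `Σ_ω G_ω = 𝒢` `Re`-positive
# semidefinite, `R` real and `0 ≤ x ≤ X`, the coercivity datum of `UnitLatticeOmegaBoxEnd.termSum_box_end` holds with
# `γ = 1` AUTOMATICALLY and the ONE bound scales with `x` — so (I4)'s Ω-side is: ONE `pieceMaj` bound on the UNSCALED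
# pieces `R·G_ω·Rᵀ` (rows + columns) + «𝒢 Re-psd» + x-FREE numbers at level `X` (R25), giving `(1 + x·R𝒢Rᵀ)⁻¹` as the
# s ≡ 1 value for EVERY `x ∈ [0, X]`

HONEST FRAMING (cell rule).  Discharging `BetaPertH` makes Bałaban's UV stability UNCONDITIONAL — a real constructive-QFT
result; NOT the continuum limit, NOT the Clay problem.  This module discharges NOTHING of `BetaPertH`.  [folklore]
bookkeeping, kernel-checked (unit `b2b-balaban-beta-d4-p3`, road P3, gen 5; skeleton v1.13 §7.10; journal l.14586).  The
row owner's THEOREM A∕B∕Proj (`AnalyticWalkSum216RowResolvent(Omega,Proj)`, p217179∕p217377∕p218312) recombine the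
G̃₂-pieces with the Ω-expansion of `(1 + x·R·G̃₂·Rᵀ)⁻¹` (pieces `pieceK R Rᵀ G x`); his interface item (I4) asks for
«Ω-data for the pieces R·G̃₂(ω)·Rᵀ of the x-tilt + x-uniform local inverses (A2) + level-X smallness (ρ2∕R25)».  On a box,
with this lineage's END, that Ω-data IS: `hT₀`∕`hTc₀` (one localised bound on `R·G_ω·Rᵀ`, rows and columns), `hpsd`
(`Re g*𝒢g ≥ 0` — 𝒢 = G̃₂ is a covariance), `hR` (`R` has real entries: `Rᴴ = Rᵀ`), row-locality of `R·G_ω·Rᵀ` in cells, the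
near convention, and NUMBERS at level `X` — nothing x-dependent, no separate coercivity datum, no separate local-inverse
input.  Nothing of Bałaban's operators is instantiated ((T3) = the bound on the G̃₂-pieces over NODE O.2); readiness width 0
unchanged; NOT summit progress.
HONEST DEPENDENCY: continuum YM on T⁴ ⇐ BetaPertH ∧ nine spine estimates (0/9 proved); BetaPertH ⇐
(D1) ∧ (D4) ∧ CAP+tail; G-an2-4 gates asym, D1 and NE2/3/4.

CITATION (locator only; nothing printed is used as a hypothesis).  [II] = T. Bałaban, *Renormalization group approach to
lattice gauge field theories. II. Cluster expansions*, Commun. Math. Phys. **116**, 1–22 (1988) [Balaban1988RG2Cluster],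
p. 13 after (2.7) («the additional term −½x‖χ*(QA + D̄μ(QA))‖² … G̃₃(x)»), (2.16)–(2.17) p. 16 (x-uniformity).

CONTENTS (0 sorry).  §1 `pieceMaj_pieceK` (the weight-sum scales by `‖x‖`), `rowBound_pieceK`∕`colBound_pieceK` (the ONE
bound at level `x` from the unscaled one, constant `X·ρ₀`), `cells_pieceK`, **`reCoercive_one_add_tilt`** (`γ = 1`: `R`
real, `𝒢` Re-psd, `x ≥ 0`).  §2 **`termSum_box_tilt`** — `termSum_box_end` for the tilt pieces, every `x ∈ [0, X]`, x-free
hypotheses.  §3 non-vacuity.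
-/

open scoped BigOperators Matrix
open Finset Matrix Metric Real

namespace Summit.QuantumFields.BalabanUV.Beta.UnitLatticeOmegaBoxTilt

open Summit.QuantumFields.BalabanUV.Beta.UnitLatticeWalkInversion
open Summit.QuantumFields.BalabanUV.Beta.UnitLatticeTubeCount (supDist supDistOn)
open Summit.QuantumFields.BalabanUV.Beta.UnitLatticePartition (hPart EPart)
open Summit.QuantumFields.BalabanUV.Beta.UnitLatticeWalkInversionDecay (locInv)
open Summit.QuantumFields.BalabanUV.Beta.UnitLatticeOmegaTerms
open Summit.QuantumFields.BalabanUV.Beta.UnitLatticeOmegaRowData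
open Summit.QuantumFields.BalabanUV.Beta.UnitLatticeOmegaBox
open Summit.QuantumFields.BalabanUV.Beta.UnitLatticeOmegaBoxEnd
open Summit.QuantumFields.BalabanUV.Beta.AccretiveCombesThomas (star_dotProduct_mulVec_eq)
open Summit.QuantumFields.BalabanUV.Beta.AnalyticWalkSum216 (termSum)
open Summit.QuantumFields.BalabanUV.Beta.AnalyticWalkSum216RowResolvent (pieceMaj pieceK Ktot_pieceK norm_pieceK_apply)
open Literature.MathematicalPhysics.QuantumFieldTheory.Balaban1983to89.B5Prop11Lower (nsq nsq_nonneg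
  star_dotProduct_self)

noncomputable section

variable {Y : Type*} [Fintype Y] [DecidableEq Y] {Ω : Type*} [Fintype Ω] [DecidableEq Ω] {Δ : Type*}

/-! ## §1 Scaling of the ONE bound; the coercivity datum of the tilt is automatic -/

section Scaling

variable {d : Y → Y → ℝ}

omit [DecidableEq Y] [Fintype Ω] [DecidableEq Ω] in
/-- The decorated weight of a scaled piece: `pieceMaj w (x·M_ω) = ‖x‖·pieceMaj w M_ω`. [folklore] -/
theorem pieceMaj_pieceK (w : ℝ) (Rm : Matrix Y Y ℂ) (G : Ω → Matrix Y Y ℂ) (cellsOf : Ω → Finset Δ) (x : ℂ) (ω : Ω)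
    (k l : Y) : pieceMaj w (pieceK Rm Rmᵀ G x) cellsOf ω k l = ‖x‖ * pieceMaj w (fun ω => Rm * G ω * Rmᵀ) cellsOf ω k l := by
  rw [pieceMaj, pieceMaj, norm_pieceK_apply]
  ring

omit [DecidableEq Y] [DecidableEq Ω] in
/-- **The ONE bound at level `x` from the unscaled one** (rows): constant `X·ρ₀` for `‖x‖ ≤ X`. [folklore] -/
theorem rowBound_pieceK {w κp ρ₀ X : ℝ} (Rm : Matrix Y Y ℂ) (G : Ω → Matrix Y Y ℂ) (cellsOf : Ω → Finset Δ) {x : ℂ}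
    (hx : ‖x‖ ≤ X)
    (hT₀ : ∀ k, ∑ l, (∑ ω, pieceMaj w (fun ω => Rm * G ω * Rmᵀ) cellsOf ω k l) * Real.exp (κp * d k l) ≤ ρ₀) (k : Y) :
    ∑ l, (∑ ω, pieceMaj w (pieceK Rm Rmᵀ G x) cellsOf ω k l) * Real.exp (κp * d k l) ≤ X * ρ₀ := by
  have hS0 : 0 ≤ ∑ l, (∑ ω, pieceMaj w (fun ω => Rm * G ω * Rmᵀ) cellsOf ω k l) * Real.exp (κp * d k l) :=
    Finset.sum_nonneg fun l _ => mul_nonneg (Finset.sum_nonneg fun ω _ =>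
      mul_nonneg (Real.exp_pos _).le (norm_nonneg _)) (Real.exp_pos _).le
  simp_rw [pieceMaj_pieceK]
  calc ∑ l, (∑ ω, ‖x‖ * pieceMaj w (fun ω => Rm * G ω * Rmᵀ) cellsOf ω k l) * Real.exp (κp * d k l)
      = ‖x‖ * ∑ l, (∑ ω, pieceMaj w (fun ω => Rm * G ω * Rmᵀ) cellsOf ω k l) * Real.exp (κp * d k l) := by
        rw [Finset.mul_sum]
        refine Finset.sum_congr rfl fun l _ => ?_
        rw [← Finset.mul_sum]
        ring
    _ ≤ X * ρ₀ :=
        (mul_le_mul_of_nonneg_right hx hS0).trans (mul_le_mul_of_nonneg_left (hT₀ k) ((norm_nonneg x).trans hx))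

omit [DecidableEq Y] [DecidableEq Ω] in
/-- The same for columns. [folklore] -/
theorem colBound_pieceK {w κp ρc₀ X : ℝ} (Rm : Matrix Y Y ℂ) (G : Ω → Matrix Y Y ℂ) (cellsOf : Ω → Finset Δ) {x : ℂ}
    (hx : ‖x‖ ≤ X)
    (hTc₀ : ∀ l, ∑ k, (∑ ω, pieceMaj w (fun ω => Rm * G ω * Rmᵀ) cellsOf ω k l) * Real.exp (κp * d k l) ≤ ρc₀) (l : Y) :
    ∑ k, (∑ ω, pieceMaj w (pieceK Rm Rmᵀ G x) cellsOf ω k l) * Real.exp (κp * d k l) ≤ X * ρc₀ := by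
  have hS0 : 0 ≤ ∑ k, (∑ ω, pieceMaj w (fun ω => Rm * G ω * Rmᵀ) cellsOf ω k l) * Real.exp (κp * d k l) :=
    Finset.sum_nonneg fun k _ => mul_nonneg (Finset.sum_nonneg fun ω _ =>
      mul_nonneg (Real.exp_pos _).le (norm_nonneg _)) (Real.exp_pos _).le
  simp_rw [pieceMaj_pieceK]
  calc ∑ k, (∑ ω, ‖x‖ * pieceMaj w (fun ω => Rm * G ω * Rmᵀ) cellsOf ω k l) * Real.exp (κp * d k l)
      = ‖x‖ * ∑ k, (∑ ω, pieceMaj w (fun ω => Rm * G ω * Rmᵀ) cellsOf ω k l) * Real.exp (κp * d k l) := by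
        rw [Finset.mul_sum]
        refine Finset.sum_congr rfl fun k _ => ?_
        rw [← Finset.mul_sum]
        ring
    _ ≤ X * ρc₀ :=
        (mul_le_mul_of_nonneg_right hx hS0).trans (mul_le_mul_of_nonneg_left (hTc₀ l) ((norm_nonneg x).trans hx))

end Scaling

omit [DecidableEq Y] [Fintype Ω] [DecidableEq Ω] in
/-- Row-locality in cells passes to the scaled pieces. [folklore] -/
theorem cells_pieceK {ν : ℕ} (Md : ℕ) (e : Y → (Fin ν → ℤ)) (Rm : Matrix Y Y ℂ) (G : Ω → Matrix Y Y ℂ)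
    (cellsOf : Ω → Finset (Fin ν → ℤ)) (hKcells₀ : ∀ ω k l, (Rm * G ω * Rmᵀ) k l ≠ 0 → cellAt Md e k ∈ cellsOf ω)
    (x : ℂ) : ∀ ω k l, pieceK Rm Rmᵀ G x ω k l ≠ 0 → cellAt Md e k ∈ cellsOf ω := fun ω k l hne => by
  refine hKcells₀ ω k l fun h0 => hne ?_
  rw [pieceK, Matrix.smul_apply, h0, smul_zero]

omit [Fintype Y] [DecidableEq Y] [Fintype Ω] [DecidableEq Ω] in
/-- A matrix with real entries satisfies `(Rᵀ)ᴴ = R`. [folklore] -/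
theorem conjTranspose_transpose_of_real (Rm : Matrix Y Y ℂ) (hR : ∀ i j, (starRingEnd ℂ) (Rm i j) = Rm i j) :
    Rmᵀᴴ = Rm := by
  ext i j
  simp [Matrix.conjTranspose_apply, Matrix.transpose_apply, hR]

omit [DecidableEq Ω] in
/-- **THE COERCIVITY DATUM OF THE TILT IS AUTOMATIC**: `R` with real entries, `𝒢 = Σ_ω G_ω` `Re`-positive semidefinite,
`x ≥ 0` real ⟹ `‖z‖² ≤ Re z^*(1 + Σ_ω x·(R·G_ω·Rᵀ))z` (γ = 1). [cite: Balaban1988RG2Cluster, p.13 after (2.7)] -/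
theorem reCoercive_one_add_tilt (Rm : Matrix Y Y ℂ) (hR : ∀ i j, (starRingEnd ℂ) (Rm i j) = Rm i j)
    (G : Ω → Matrix Y Y ℂ) (hpsd : ∀ g : Y → ℂ, 0 ≤ (star g ⬝ᵥ (Ktot G *ᵥ g)).re) {x : ℝ} (hx : 0 ≤ x) (z : Y → ℂ) :
    1 * nsq z ≤ (star z ⬝ᵥ ((1 + Ktot (pieceK Rm Rmᵀ G (x : ℂ))) *ᵥ z)).re := by
  have h : star z ⬝ᵥ ((Rm * Ktot G * Rmᵀ) *ᵥ z) = star (Rmᵀ *ᵥ z) ⬝ᵥ (Ktot G *ᵥ (Rmᵀ *ᵥ z)) := by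
    rw [← Matrix.mulVec_mulVec, ← Matrix.mulVec_mulVec, Matrix.dotProduct_mulVec, Matrix.star_mulVec,
      conjTranspose_transpose_of_real Rm hR]
  rw [Ktot_pieceK, Matrix.add_mulVec, Matrix.one_mulVec, dotProduct_add, Complex.add_re, star_dotProduct_self,
    Complex.ofReal_re, one_mul, Matrix.smul_mulVec, dotProduct_smul, smul_eq_mul, Complex.re_ofReal_mul, h]
  exact le_add_of_nonneg_right (mul_nonneg hx (hpsd _))

/-! ## §2 The x-tilt layer on a box -/

section Box

variable {ν q : ℕ}

/-- **THE x-TILT LAYER ON A BOX, EVERY `x ∈ [0, X]`, x-FREE HYPOTHESES.**  As `UnitLatticeOmegaBoxEnd.termSum_box_end` for the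
pieces `pieceK R Rᵀ G x = x·(R·G_ω·Rᵀ)`: the ONE bound is assumed for the UNSCALED pieces (`hT₀` rows, `hTc₀` columns,
constants `ρ₀`, `ρc₀`), the coercivity datum is REPLACED by «`R` real, `Σ_ω G_ω` Re-psd», and the numeric inequalities are
those of the END at `ρ := X·ρ₀`, `ρ_c := X·ρc₀`, `γ := 1` — so they hold at level `X` once and serve every `x ≤ X`
([II] p. 16's x-uniformity; R25 in our letters).  Conclusion: at `s ≡ 1` the fully decorated ω-expansion with the
constructed local inverses sums to `(1 + x·R·(Σ_ωG_ω)·Rᵀ)⁻¹`. [cite: Balaban1988RG2Cluster, p.13 after (2.7)] -/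
theorem termSum_box_tilt (hν : 0 < ν) {M Md : ℕ} (hM : 0 < M) (hMd : 8 * M ≤ Md) (e : Y → (Fin ν → ℤ))
    (he : Function.Injective e) (hbox : ∀ y i, 0 ≤ e y i ∧ e y i ≤ q * M)
    {κ κ₁ κ₂ κp ρ₀ ρc₀ m₀ κc X : ℝ} (hκ : 0 ≤ κ) (hκ₁ : 0 < κ₁) (hκ₂ : 0 ≤ κ₂)
    (Rm : Matrix Y Y ℂ) (hR : ∀ i j, (starRingEnd ℂ) (Rm i j) = Rm i j) (G : Ω → Matrix Y Y ℂ)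
    (hpsd : ∀ g : Y → ℂ, 0 ≤ (star g ⬝ᵥ (Ktot G *ᵥ g)).re) (cellsOf : Ω → Finset (Fin ν → ℤ))
    (hKcells₀ : ∀ ω k l, (Rm * G ω * Rmᵀ) k l ≠ 0 → cellAt Md e k ∈ cellsOf ω)
    (near : (Fin ν → Fin (q + 1)) → Finset Ω) (hnear : ∀ b ω, ω ∉ near b → m₀ ≤ (cellsOf ω).card)
    (hκc : κ + κ₁ * ((2 ^ ν : ℕ) / (2 * (M : ℝ))) < κc) (hκcp : κc < κp)
    (hT₀ : ∀ k, ∑ l, (∑ ω, pieceMaj (κ₁ + κ₂) (fun ω => Rm * G ω * Rmᵀ) cellsOf ω k l)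
      * Real.exp (κp * supDistOn e k l) ≤ ρ₀)
    (hTc₀ : ∀ l, ∑ k, (∑ ω, pieceMaj (κ₁ + κ₂) (fun ω => Rm * G ω * Rmᵀ) cellsOf ω k l)
      * Real.exp (κp * supDistOn e k l) ≤ ρc₀)
    (hm : κc * (X * ρ₀) * ((Real.exp 1 * ((κp - κc) / 2))⁻¹
          * (2 * (1 - Real.exp (-((κp - κc - (κp - κc) / 2) / ν)))⁻¹) ^ ν)
        < 1 - Real.exp (-((κ₁ + κ₂) * m₀)) * (X * ρ₀ + X * ρc₀) / 2)
    (hρ : (1 - Real.exp (-((κ₁ + κ₂) * m₀)) * (X * ρ₀ + X * ρc₀) / 2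
          - κc * (X * ρ₀) * ((Real.exp 1 * ((κp - κc) / 2))⁻¹
            * (2 * (1 - Real.exp (-((κp - κc - (κp - κc) / 2) / ν)))⁻¹) ^ ν))⁻¹
        * (2 * (1 - Real.exp (-((κc - (κ + κ₁ * ((2 ^ ν : ℕ) / (2 * (M : ℝ))))) / ν)))⁻¹) ^ ν
        * (2 * (2 : ℝ) ^ ν / (2 * (M : ℝ) / (ν * π))
          * ((Real.exp 1 * (κp - (κ + κ₁ * ((2 ^ ν : ℕ) / (2 * (M : ℝ))))))⁻¹ * (X * ρ₀))
          + (2 : ℝ) ^ ν * Real.exp (-(κ₂ * m₀)) * (X * ρ₀)) < 1)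
    {x : ℝ} (hx0 : 0 ≤ x) (hxX : x ≤ X) (Δ₀ : Fin ν → ℤ) :
    termSum (decFamilyΩ (cellAt Md e) (EPart M q e) (domOf Md e cellsOf) (hPart M q e) (pieceK Rm Rmᵀ G (x : ℂ)) near
      (fun b => locInv (Knear (pieceK Rm Rmᵀ G (x : ℂ)) near b) (EPart M q e) b) (fun _ => (1 : ℂ)) Δ₀) 1
      = (1 + (x : ℂ) • (Rm * Ktot G * Rmᵀ))⁻¹ := by
  have hx : ‖(x : ℂ)‖ ≤ X := by rw [Complex.norm_real, Real.norm_of_nonneg hx0]; exact hxX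
  rw [← Ktot_pieceK]
  exact termSum_box_end hν hM hMd e he hbox hκ hκ₁ hκ₂ (pieceK Rm Rmᵀ G (x : ℂ)) cellsOf
    (cells_pieceK Md e Rm G cellsOf hKcells₀ (x : ℂ)) near hnear hκc hκcp
    (rowBound_pieceK Rm G cellsOf hx hT₀) (colBound_pieceK Rm G cellsOf hx hTc₀)
    (reCoercive_one_add_tilt Rm hR G hpsd hx0) hm hρ Δ₀

end Box

end

end Summit.QuantumFields.BalabanUV.Beta.UnitLatticeOmegaBoxTilt
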